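import Literature.NumberTheory.Automorphic.UnitaryGroupStableOrbitalIntegral
import HarnessLib

/-!
# The orbital terms of the anisotropic inner form in orbital-integral currency, for ANY admissible family of orbital measures:
# `Φ F [γ] = C · w[γ] · Φ_μ(γ, F)` — independence of the chosen invariant measures up to positive weights
(Rogawski, *Automorphic representations of unitary groups in three variables* (1990), §14.5 p. 237 (print): `J_{G′}(f′) = Σ_γ a_γ Φ(γ, f′)`;
Gelbart (1975), (9.13); uniqueness of invariant measures on `G ⧸ G_γ`: Getz–Hahn (2024), Thm. 3.2.2)

Topic `NumberTheory/Automorphic`; namespace `Literature.NumberTheory.Automorphic.UnitaryGroup`; THEOREMS ONLY (no def, no instance, no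
named fact, no `sorry`), on top of ★ T1b-3 `UnitaryGroupStableOrbitalIntegral` (bridge `IsOrbitalTerms.exists_eq_mul_adelicClassOrbitalIntegral`,
which PRODUCES one admissible family) and ★ `InvariantQuotientUniqueness` (`smulInvariantMeasure_quotient_unique_ne_zero`).

WHY.  The floor-0 line pins the anchored kit's `J 𝒪 f′ := 𝒪.orbitalSum (Φ f′)` with `IsOrbitalTerms Φ` (ed. 1.14 (viii)); pins and the
Euler factorisation (O2) want to read `Φ f′ [γ]` as an orbital integral against a family `μ` THEY supply (e.g. ★ O1
`exists_adelicOrbitalMeasureFamily_of_isRegularElt`, or O2's restricted product of local measures).  Since two non-zero invariant Radon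
measures on `U(H)(𝔸) ⧸ U(H)(𝔸)_γ` differ by a positive scalar, the genuine terms are `C · w_μ[γ] · Φ_μ(γ, F)` for EVERY family `μ`
admissible at `[γ]`, with `μ`-dependent positive weights:

* `IsOrbitalTerms.exists_weight_pos_of_admissibleAt` — for every family `μ` and every class `c` at which `μ c` is non-zero, invariant and
  finite on compact sets there is `b > 0` with `Φ_μ(γ_c, F) = b · Φ F c` for all `F`;
* `IsOrbitalTerms.exists_weight_orbitalSum_eq_of_admissible` — for a family admissible at ALL classes: a positive weight function `a`
  with `𝒪_st.orbitalSum (Φ F) = 𝒪_st.orbitalSum (a · Φ_μ(·, F))` for every stable class (the anchored kit's `J(𝒪_st, f′)` re-read);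
* `exists_weight_diagTrace_eq_finsum_orbitalSum_of_admissible` — T1a for the anisotropic `G′` against ANY all-class-admissible family:
  `θ_{G′}(F) = Σᶠ_{𝒪_st} 𝒪_st.orbitalSum ([γ] ↦ a[γ] · Φ_μ(γ, F))`.
(The orbit spaces carry ANY `[MeasurableSpace] [BorelSpace]` instance family — equal to the Borel one of ★ `IsOrbitalTerms`, `measurableSpace_orbitSpace_eq_borel`.)

## References
* J. D. Rogawski, *Automorphic Representations of Unitary Groups in Three Variables*, Ann. of Math. Stud. 123 (1990), §14.5 p. 237 (print)
  [Rogawski1990].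
* J. R. Getz, H. Hahn, *An Introduction to Automorphic Representations* (2024), Thm. 3.2.2 (printed p. 57) [GetzHahn2024].
-/

noncomputable section

open MeasureTheory Measure Set Filter Topology NumberField CompactlySupported
open Literature.MeasureTheory.Group
open scoped ENNReal NNReal Pointwise

namespace Literature.NumberTheory.Automorphic

namespace UnitaryGroup

open Literature.NumberTheory.Rogawski1990
open Literature.AlgebraicGeometry.ShimuraVarieties (hermForm)

variable (L : Type) [Field L] [NumberField L] [IsCMField L] (N : ℕ) (H : Matrix (Fin N) (Fin N) L)
  [instMS : ∀ g : (cmDatum L N H).Adelic,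
    MeasurableSpace ((cmDatum L N H).Adelic ⧸ Subgroup.centralizer ({g} : Set (cmDatum L N H).Adelic))]
  [instBS : ∀ g : (cmDatum L N H).Adelic,
    BorelSpace ((cmDatum L N H).Adelic ⧸ Subgroup.centralizer ({g} : Set (cmDatum L N H).Adelic))]

/-- Any family of Borel-space structures on the adelic orbit spaces IS the family of Borel σ-algebras (the convention fixed inside ★
`IsOrbitalTerms`), as an equality of instance families. [cite: Rogawski1990, §14.5 p. 237] -/
theorem measurableSpace_orbitSpace_eq_borel :
    instMS = fun g => borel ((cmDatum L N H).Adelic ⧸ Subgroup.centralizer ({g} : Set (cmDatum L N H).Adelic)) :=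
  funext fun g => (instBS g).measurable_eq

/-- **The genuine orbital terms against ANY family admissible at a class**: if `IsOrbitalTerms L N H Φ`, then for every rational-class-indexed
family `μ` of measures on the adelic orbit spaces (Borel σ-algebras) and every class `c` at which `μ c` is `U(H)(𝔸)`-invariant, finite on
compact sets and non-zero, there is a weight `b > 0` with `Φ_μ(γ_c, F) = b · Φ F c` for all `F` (★ T1b-3 bridge, which produces ITS OWN family,
+ uniqueness of invariant Radon measures on `U(H)(𝔸) ⧸ U(H)(𝔸)_γ` up to a positive scalar, ★ `smulInvariantMeasure_quotient_unique_ne_zero`).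
[cite: Rogawski1990, §14.5 p. 237] -/
theorem IsOrbitalTerms.exists_weight_pos_of_admissibleAt
    {Φ : C_c((cmDatum L N H).Adelic, ℂ) → ConjClasses (cmDatum L N H).Rational → ℂ} (hΦ : IsOrbitalTerms L N H Φ) :
    ∀ (μ : AdelicOrbitalMeasureFamily L N H) (c : ConjClasses (cmDatum L N H).Rational),
      SMulInvariantMeasure (cmDatum L N H).Adelic _ (μ c) → IsFiniteMeasureOnCompacts (μ c) → μ c ≠ 0 →
        ∃ b : ℝ, 0 < b ∧ ∀ F : C_c((cmDatum L N H).Adelic, ℂ), adelicClassOrbitalIntegral L N H μ F c = (b : ℂ) * Φ F c := by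
  have hMS := measurableSpace_orbitSpace_eq_borel L N H
  subst hMS
  letI instMS' : ∀ g : (cmDatum L N H).Adelic, MeasurableSpace ((cmDatum L N H).Adelic ⧸
      Subgroup.centralizer ({g} : Set (cmDatum L N H).Adelic)) := fun g => borel _
  haveI : ∀ g : (cmDatum L N H).Adelic, BorelSpace ((cmDatum L N H).Adelic ⧸
      Subgroup.centralizer ({g} : Set (cmDatum L N H).Adelic)) := fun _ => ⟨rfl⟩
  letI : MeasurableSpace (cmDatum L N H).Adelic := borel _
  haveI : BorelSpace (cmDatum L N H).Adelic := ⟨rfl⟩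
  intro μ c hinv hfin hne
  obtain ⟨C, w₀, μ₀, hC, hw₀, hμ₀, hΦF⟩ := IsOrbitalTerms.exists_eq_mul_adelicClassOrbitalIntegral L N H hΦ
  -- uniqueness: `μ₀ c = κ • μ c`
  haveI := (hμ₀ c).1
  haveI := (hμ₀ c).2.1
  haveI : IsClosed ((Subgroup.centralizer ({(cmDatum L N H).toAdelic (Quotient.out c)} : Set (cmDatum L N H).Adelic) :
      Subgroup (cmDatum L N H).Adelic) : Set (cmDatum L N H).Adelic) := Set.isClosed_centralizer _
  obtain ⟨κ, hκ0, hκ⟩ := smulInvariantMeasure_quotient_unique_ne_zero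
    (Subgroup.centralizer ({(cmDatum L N H).toAdelic (Quotient.out c)} : Set (cmDatum L N H).Adelic)) (μ₀ c) (μ c) (hμ₀ c).2.2 hne
  have hpos : (0 : ℝ) < (C : ℝ) * (w₀ c * κ : ℝ≥0) :=
    mul_pos (NNReal.coe_pos.mpr hC) (NNReal.coe_pos.mpr (pos_iff_ne_zero.mpr (mul_ne_zero (hw₀ c) hκ0)))
  refine ⟨((C : ℝ) * (w₀ c * κ : ℝ≥0))⁻¹, inv_pos.mpr hpos, fun F => ?_⟩
  have hne' : (((C : ℝ) * (w₀ c * κ : ℝ≥0) : ℝ) : ℂ) ≠ 0 := Complex.ofReal_ne_zero.mpr hpos.ne'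
  have key : Φ F c = (((C : ℝ) * (w₀ c * κ : ℝ≥0) : ℝ) : ℂ) * adelicClassOrbitalIntegral L N H μ F c := by
    rw [hΦF F c, adelicClassOrbitalIntegral, adelicClassOrbitalIntegral, classOrbitalIntegralAlong_eq, classOrbitalIntegralAlong_eq,
      orbitalIntegral_eq_integral_descConj, orbitalIntegral_eq_integral_descConj, hκ, integral_smul_nnreal_measure, NNReal.smul_def,
      Complex.real_smul, NNReal.coe_mul, Complex.ofReal_mul, Complex.ofReal_mul]
    ring
  rw [key, ← mul_assoc, Complex.ofReal_inv, inv_mul_cancel₀ hne', one_mul]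

/-- **The genuine orbital terms, as class functions, against ANY all-class-admissible family**: for `μ` non-zero, invariant and finite on
compact sets at every class there is a positive weight function `a` with `𝒪_st.orbitalSum (Φ F) = 𝒪_st.orbitalSum (a · Φ_μ(·, F))` — the
anchored kit's `J(𝒪_st, f′) = 𝒪_st.orbitalSum (Φ f′)` re-read against `μ`. [cite: Rogawski1990, §14.5 p. 237] -/
theorem IsOrbitalTerms.exists_weight_orbitalSum_eq_of_admissible
    {Φ : C_c((cmDatum L N H).Adelic, ℂ) → ConjClasses (cmDatum L N H).Rational → ℂ} (hΦ : IsOrbitalTerms L N H Φ) :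
    ∀ μ : AdelicOrbitalMeasureFamily L N H,
      (∀ c, SMulInvariantMeasure (cmDatum L N H).Adelic _ (μ c) ∧ IsFiniteMeasureOnCompacts (μ c) ∧ μ c ≠ 0) →
      ∃ a : ConjClasses (cmDatum L N H).Rational → ℝ, (∀ c, 0 < a c) ∧
        ∀ (F : C_c((cmDatum L N H).Adelic, ℂ)) (st : StableClass (cmConjRingHom L) H),
          st.orbitalSum (Φ F) = st.orbitalSum fun c => (a c : ℂ) * adelicClassOrbitalIntegral L N H μ F c := by
  have hMS := measurableSpace_orbitSpace_eq_borel L N H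
  subst hMS
  letI instMS' : ∀ g : (cmDatum L N H).Adelic, MeasurableSpace ((cmDatum L N H).Adelic ⧸
      Subgroup.centralizer ({g} : Set (cmDatum L N H).Adelic)) := fun g => borel _
  haveI : ∀ g : (cmDatum L N H).Adelic, BorelSpace ((cmDatum L N H).Adelic ⧸
      Subgroup.centralizer ({g} : Set (cmDatum L N H).Adelic)) := fun _ => ⟨rfl⟩
  intro μ hμ
  have hall := IsOrbitalTerms.exists_weight_pos_of_admissibleAt L N H hΦ
  choose b hb0 hb using fun c => hall μ c (hμ c).1 (hμ c).2.1 (hμ c).2.2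
  refine ⟨fun c => (b c)⁻¹, fun c => inv_pos.mpr (hb0 c), fun F st => ?_⟩
  have hfun : Φ F = fun c => ((b c)⁻¹ : ℝ) * adelicClassOrbitalIntegral L N H μ F c := by
    funext c
    rw [hb c F, ← mul_assoc, Complex.ofReal_inv, inv_mul_cancel₀ (Complex.ofReal_ne_zero.mpr (hb0 c).ne'), one_mul]
  exact congrArg (fun Ψ => StableClass.orbitalSum Ψ st) hfun

variable [MeasurableSpace (cmDatum L N H).Adelic] [BorelSpace (cmDatum L N H).Adelic]
  (μA : Measure (cmDatum L N H).automorphicQuotient) [(cmDatum L N H).IsAutomorphicMeasure μA]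
  (ν : Measure (cmDatum L N H).Adelic) [ν.IsHaarMeasure]

/-- **T1a against ANY all-class-admissible family of adelic orbital measures** (anisotropic `H`, `μA` automorphic, `ν` Haar; Borel
σ-algebras on the orbit spaces): for `μ` admissible at every class there is a positive weight function `a` on the rational classes with,
for every `F ∈ C_c(U(H)(𝔸_{L⁺}))`, `[γ] ↦ a[γ] · Φ_μ(γ, F)` finitely supported and
`θ_{G′}(F) = Σᶠ_{𝒪_st} 𝒪_st.orbitalSum ([γ] ↦ a[γ] · Φ_μ(γ, F))` (★ `exists_isOrbitalTerms_diagTrace_eq_finsum_stableClass` + the currency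
change). [cite: Rogawski1990, §14.5 p. 237] -/
theorem exists_weight_diagTrace_eq_finsum_orbitalSum_of_admissible
    (hanis : ∀ x : Fin N → L, hermForm (cmConjRingHom L) H x x = 0 → x = 0) :
    ∀ μ : AdelicOrbitalMeasureFamily L N H,
      (∀ c, SMulInvariantMeasure (cmDatum L N H).Adelic _ (μ c) ∧ IsFiniteMeasureOnCompacts (μ c) ∧ μ c ≠ 0) →
      ∃ a : ConjClasses (cmDatum L N H).Rational → ℝ, (∀ c, 0 < a c) ∧
        ∀ F : C_c((cmDatum L N H).Adelic, ℂ),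
          (Function.support fun c => (a c : ℂ) * adelicClassOrbitalIntegral L N H μ F c).Finite ∧
          diagTrace L N H μA ν hanis F =
            ∑ᶠ st : StableClass (cmConjRingHom L) H, st.orbitalSum fun c => (a c : ℂ) * adelicClassOrbitalIntegral L N H μ F c := by
  have hMS := measurableSpace_orbitSpace_eq_borel L N H
  subst hMS
  letI instMS' : ∀ g : (cmDatum L N H).Adelic, MeasurableSpace ((cmDatum L N H).Adelic ⧸
      Subgroup.centralizer ({g} : Set (cmDatum L N H).Adelic)) := fun g => borel _
  haveI : ∀ g : (cmDatum L N H).Adelic, BorelSpace ((cmDatum L N H).Adelic ⧸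
      Subgroup.centralizer ({g} : Set (cmDatum L N H).Adelic)) := fun _ => ⟨rfl⟩
  intro μ hμ
  obtain ⟨Φ, hΦ, hF⟩ := exists_isOrbitalTerms_diagTrace_eq_finsum_stableClass L N H μA ν hanis
  have hall := IsOrbitalTerms.exists_weight_pos_of_admissibleAt L N H hΦ
  choose b hb0 hb using fun c => hall μ c (hμ c).1 (hμ c).2.1 (hμ c).2.2
  refine ⟨fun c => (b c)⁻¹, fun c => inv_pos.mpr (hb0 c), fun F => ?_⟩
  have hfun : Φ F = fun c => ((b c)⁻¹ : ℝ) * adelicClassOrbitalIntegral L N H μ F c := by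
    funext c
    rw [hb c F, ← mul_assoc, Complex.ofReal_inv, inv_mul_cancel₀ (Complex.ofReal_ne_zero.mpr (hb0 c).ne'), one_mul]
  obtain ⟨hfin, -, hEq⟩ := hF F
  rw [hfun] at hfin hEq
  exact ⟨hfin, hEq⟩

end UnitaryGroup

end Literature.NumberTheory.Automorphic
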